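import Mathlib
import HarnessLib
import Summits.NavierStokesRegularity.NavierStokesRegularity.Theorems.TaylorModelRungThreeSoundnessVectorTaylor
import Summits.NavierStokesRegularity.NavierStokesRegularity.Theorems.TaylorModelRungThreeSoundnessFlow

/-!
# Line `taylor-model` on crux K1b-DR (`ExactWindowRungThree.DerivativeEnclosureCertificateR`,
# stmt-NavierStokesRegularity-23954) — VECTOR STEP LEMMA, part 3: the variational twin (block system) and
# the `Fin n` / `flowSel` corollaries

Third part of §1 of `pub/pub-ns-dss/certificates/S1-VECTOR-23954.md` (director dss_56 (i)).

* `exists_blockField` — the block field `(y,v) ↦ (Q(y,y), Q(y,v)+Q(v,y))` on `ι ⊕ ι → ℝ` as a bundled bilinear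
  map; its jets are `(T, U)` (`U` = S1's variational jets, `IsMajorantSystem.U_zero/U_succ` shape);
* `exists_pair_sol_mem_Icc_of_roughEnclosure` — rough-enclosure test for the PAIR (state box `[lo,hi]`,
  variation box `[loV,hiV]`, both NON-STRICT) ⇒ the solution `ψ` and the variation `V` (`V' = Q(ψ,V)+Q(V,ψ)`,
  `V 0 = v₀`) exist on `[0,h]` and stay in their boxes (instance of part 1 on `ι ⊕ ι`);
* `abs_sub_varTaylor_le` — **variational Lagrange remainder**: `|V s c − Σ_{k≤p} U (ψ 0) (V 0) k c s^k| ≤ J s^(p+1)`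
  from a bound of `U (ψ s) (V s) (p+1) c` along the pair trajectory (instance of part 2 on `ι ⊕ ι`), and its
  box form `abs_sub_varTaylor_le_of_mem_Icc`;
* `Fin n` corollaries next to S1's vocabulary (`IsMajorantSystem`, `IsSolOn`, `flowSel`): the unbundled field of
  an `IsMajorantSystem` bundles by `LinearMap.mk₂` (`exists_bundle`), and the rough-enclosure test makes the
  GLOBAL SELECTOR `flowSel Q x₀` a solution on `[0,h]` confined to the box, with the componentwise Taylor
  remainder against the jets at `x₀` (`flowSel_isSolOn_mem_Icc`, `abs_flowSel_sub_taylor_le`) — no `b·m·h < 1`.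

MODEL-lattice bookkeeping only (rung TL-M3 of the NS ladder: one finite-dimensional model ODE); nothing
here is a statement about the Navier–Stokes equations.
-/

noncomputable section

-- the sub-problem namespace repeats the summit name by design (D-0017)
set_option linter.dupNamespace false

namespace Summit.NavierStokesRegularity.NavierStokesRegularity.Theorems.TaylorModelVector

open scoped BigOperators Topology
open Set Filter

section Block

variable {ι : Type*} [Fintype ι] [DecidableEq ι]
  (Q : (ι → ℝ) →ₗ[ℝ] (ι → ℝ) →ₗ[ℝ] ι → ℝ) {T : (ι → ℝ) → ℕ → ι → ℝ}
  {U : (ι → ℝ) → (ι → ℝ) → ℕ → ι → ℝ}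

omit [Fintype ι] [DecidableEq ι] in
/-- **The block field** `(y,v) ↦ (Q(y,y'), Q(y,v')+Q(v,y'))` on `ι ⊕ ι → ℝ`, bundled bilinear (the system solved by
a trajectory together with its first variation). [folklore] -/
theorem exists_blockField :
    ∃ Q₂ : (ι ⊕ ι → ℝ) →ₗ[ℝ] (ι ⊕ ι → ℝ) →ₗ[ℝ] (ι ⊕ ι → ℝ), ∀ z z' : ι ⊕ ι → ℝ,
      Q₂ z z' = Sum.elim (Q (z ∘ Sum.inl) (z' ∘ Sum.inl))
        (Q (z ∘ Sum.inl) (z' ∘ Sum.inr) + Q (z ∘ Sum.inr) (z' ∘ Sum.inl)) := by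
  refine ⟨LinearMap.mk₂ ℝ (fun z z' : ι ⊕ ι → ℝ => Sum.elim (Q (z ∘ Sum.inl) (z' ∘ Sum.inl))
      (Q (z ∘ Sum.inl) (z' ∘ Sum.inr) + Q (z ∘ Sum.inr) (z' ∘ Sum.inl))) ?_ ?_ ?_ ?_, fun z z' => rfl⟩
  · intro z₁ z₂ z'
    have e1 : (z₁ + z₂) ∘ Sum.inl = z₁ ∘ Sum.inl + z₂ ∘ Sum.inl := rfl
    have e2 : (z₁ + z₂) ∘ Sum.inr = z₁ ∘ Sum.inr + z₂ ∘ Sum.inr := rfl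
    funext c
    rcases c with c | c
    · simp only [e1, Sum.elim_inl, Pi.add_apply, map_add, LinearMap.add_apply]
    · simp only [e1, e2, Sum.elim_inr, Pi.add_apply, map_add, LinearMap.add_apply]
      ring
  · intro r z z'
    have e1 : (r • z) ∘ Sum.inl = r • (z ∘ Sum.inl) := rfl
    have e2 : (r • z) ∘ Sum.inr = r • (z ∘ Sum.inr) := rfl
    funext c
    rcases c with c | c
    · simp only [e1, Sum.elim_inl, Pi.smul_apply, map_smul, LinearMap.smul_apply]
    · simp only [e1, e2, Sum.elim_inr, Pi.smul_apply, Pi.add_apply, map_smul, LinearMap.smul_apply,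
        smul_eq_mul]
      ring
  · intro z z₁ z₂
    have e1 : (z₁ + z₂) ∘ Sum.inl = z₁ ∘ Sum.inl + z₂ ∘ Sum.inl := rfl
    have e2 : (z₁ + z₂) ∘ Sum.inr = z₁ ∘ Sum.inr + z₂ ∘ Sum.inr := rfl
    funext c
    rcases c with c | c
    · simp only [e1, Sum.elim_inl, Pi.add_apply, map_add]
    · simp only [e1, e2, Sum.elim_inr, Pi.add_apply, map_add]
      ring
  · intro r z z'
    have e1 : (r • z') ∘ Sum.inl = r • (z' ∘ Sum.inl) := rfl
    have e2 : (r • z') ∘ Sum.inr = r • (z' ∘ Sum.inr) := rfl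
    funext c
    rcases c with c | c
    · simp only [e1, Sum.elim_inl, Pi.smul_apply, map_smul]
    · simp only [e1, e2, Sum.elim_inr, Pi.smul_apply, Pi.add_apply, map_smul, smul_eq_mul]
      ring

/-- **Rough-enclosure test for the PAIR (trajectory + first variation)**: if `x₀ ∈ [lo,hi]`, `v₀ ∈ [loV,hiV]`,
`x₀ + u • Q y y ∈ [lo,hi]` and `v₀ + u • (Q y v + Q v y) ∈ [loV,hiV]` for all `y ∈ [lo,hi]`, `v ∈ [loV,hiV]`,
`u ∈ [0,h]`, then the solution `ψ` from `x₀` and the variation `V` (`V' = Q(ψ,V) + Q(V,ψ)`, `V 0 = v₀`) exist on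
`[0,h]` and stay in their boxes. [folklore] -/
theorem exists_pair_sol_mem_Icc_of_roughEnclosure {lo hi x₀ loV hiV v₀ : ι → ℝ} {h : ℝ}
    (hx₀ : x₀ ∈ Icc lo hi) (hv₀ : v₀ ∈ Icc loV hiV) (hh : 0 ≤ h)
    (henc : ∀ y ∈ Icc lo hi, ∀ u ∈ Icc (0:ℝ) h, x₀ + u • Q y y ∈ Icc lo hi)
    (hencV : ∀ y ∈ Icc lo hi, ∀ v ∈ Icc loV hiV, ∀ u ∈ Icc (0:ℝ) h,
      v₀ + u • (Q y v + Q v y) ∈ Icc loV hiV) :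
    ∃ ψ V : ℝ → ι → ℝ, ψ 0 = x₀ ∧ V 0 = v₀ ∧
      (∀ s ∈ Icc 0 h, HasDerivWithinAt ψ (Q (ψ s) (ψ s)) (Icc 0 h) s) ∧
      (∀ s ∈ Icc 0 h, HasDerivWithinAt V (Q (ψ s) (V s) + Q (V s) (ψ s)) (Icc 0 h) s) ∧
      (∀ s ∈ Icc 0 h, ψ s ∈ Icc lo hi) ∧ (∀ s ∈ Icc 0 h, V s ∈ Icc loV hiV) := by
  obtain ⟨Q₂, hQ₂⟩ := exists_blockField Q
  have hx₂ : Sum.elim x₀ v₀ ∈ Icc (Sum.elim lo loV) (Sum.elim hi hiV) := by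
    refine ⟨?_, ?_⟩ <;> rintro (c | c)
    exacts [hx₀.1 c, hv₀.1 c, hx₀.2 c, hv₀.2 c]
  have henc₂ : ∀ y₂ ∈ Icc (Sum.elim lo loV) (Sum.elim hi hiV), ∀ u ∈ Icc (0:ℝ) h,
      Sum.elim x₀ v₀ + u • Q₂ y₂ y₂ ∈ Icc (Sum.elim lo loV) (Sum.elim hi hiV) := by
    intro y₂ hy₂ u hu
    have hy : y₂ ∘ Sum.inl ∈ Icc lo hi := ⟨fun c => hy₂.1 (Sum.inl c), fun c => hy₂.2 (Sum.inl c)⟩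
    have hv : y₂ ∘ Sum.inr ∈ Icc loV hiV := ⟨fun c => hy₂.1 (Sum.inr c), fun c => hy₂.2 (Sum.inr c)⟩
    have h1 := henc _ hy u hu
    have h2 := hencV _ hy _ hv u hu
    rw [hQ₂]
    refine ⟨?_, ?_⟩ <;> rintro (c | c)
    · simpa using h1.1 c
    · have h' := h2.1 c
      simp only [Pi.add_apply, Pi.smul_apply, smul_eq_mul, Sum.elim_inr] at h' ⊢
      linarith
    · simpa using h1.2 c
    · have h' := h2.2 c
      simp only [Pi.add_apply, Pi.smul_apply, smul_eq_mul, Sum.elim_inr] at h' ⊢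
      linarith
  obtain ⟨ψ₂, h0, hder, hbox⟩ := exists_sol_mem_Icc_of_roughEnclosure Q₂ hx₂ hh henc₂
  refine ⟨fun s => ψ₂ s ∘ Sum.inl, fun s => ψ₂ s ∘ Sum.inr, ?_, ?_, ?_, ?_, ?_, ?_⟩
  · funext c; simp [h0]
  · funext c; simp [h0]
  · intro s hs
    refine hasDerivWithinAt_pi.2 fun c => ?_
    have h1 := (hasDerivWithinAt_pi.1 (hder s hs)) (Sum.inl c)
    rw [hQ₂] at h1
    simpa using h1
  · intro s hs
    refine hasDerivWithinAt_pi.2 fun c => ?_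
    have h1 := (hasDerivWithinAt_pi.1 (hder s hs)) (Sum.inr c)
    rw [hQ₂] at h1
    simpa using h1
  · exact fun s hs => ⟨fun c => (hbox s hs).1 (Sum.inl c), fun c => (hbox s hs).2 (Sum.inl c)⟩
  · exact fun s hs => ⟨fun c => (hbox s hs).1 (Sum.inr c), fun c => (hbox s hs).2 (Sum.inr c)⟩

/-- **VARIATIONAL LAGRANGE REMAINDER**: along a solution `ψ` and a solution `V` of the variational equation
`V' = Q(ψ,V) + Q(V,ψ)` on `[0,h]`, a bound `|U (ψ s) (V s) (p+1) c| ≤ J` of one coordinate of the order-`p+1`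
variational jet along the pair gives `|V s c − Σ_{k≤p} U (ψ 0) (V 0) k c s^k| ≤ J s^(p+1)` (the componentwise
Lagrange remainder of part 2 for the block system, whose jets are `(T, U)`). [folklore] -/
theorem abs_sub_varTaylor_le (hT0 : ∀ x, T x 0 = x)
    (hTs : ∀ x (k : ℕ) c, ((k : ℝ) + 1) * T x (k + 1) c =
      ∑ i ∈ Finset.range (k + 1), Q (T x i) (T x (k - i)) c)
    (hU0 : ∀ x v, U x v 0 = v)
    (hUs : ∀ x v (k : ℕ) c, ((k : ℝ) + 1) * U x v (k + 1) c =
      ∑ i ∈ Finset.range (k + 1), (Q (T x i) (U x v (k - i)) c + Q (U x v (k - i)) (T x i) c))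
    {ψ V : ℝ → ι → ℝ} {h : ℝ} (hψ : ∀ s ∈ Icc 0 h, HasDerivWithinAt ψ (Q (ψ s) (ψ s)) (Icc 0 h) s)
    (hV : ∀ s ∈ Icc 0 h, HasDerivWithinAt V (Q (ψ s) (V s) + Q (V s) (ψ s)) (Icc 0 h) s)
    {p : ℕ} {c : ι} {J : ℝ} (hJ : ∀ s ∈ Icc 0 h, |U (ψ s) (V s) (p + 1) c| ≤ J) :
    ∀ s ∈ Icc 0 h, |V s c - ∑ k ∈ Finset.range (p + 1), U (ψ 0) (V 0) k c * s ^ k| ≤ J * s ^ (p + 1) := by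
  obtain ⟨Q₂, hQ₂⟩ := exists_blockField Q
  obtain ⟨T₂, hT₂⟩ : ∃ T₂ : (ι ⊕ ι → ℝ) → ℕ → ι ⊕ ι → ℝ,
      T₂ = fun z k => Sum.elim (T (z ∘ Sum.inl) k) (U (z ∘ Sum.inl) (z ∘ Sum.inr) k) := ⟨_, rfl⟩
  have hT0₂ : ∀ z, T₂ z 0 = z := fun z => by
    simp only [hT₂, hT0, hU0, Sum.elim_comp_inl_inr]
  have hTs₂ : ∀ z (k : ℕ) c₂, ((k : ℝ) + 1) * T₂ z (k + 1) c₂ =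
      ∑ i ∈ Finset.range (k + 1), Q₂ (T₂ z i) (T₂ z (k - i)) c₂ := by
    intro z k c₂
    simp only [hT₂, hQ₂, Sum.elim_comp_inl, Sum.elim_comp_inr]
    rcases c₂ with c | c
    · simp only [Sum.elim_inl]
      exact hTs _ k c
    · simp only [Sum.elim_inr, Pi.add_apply]
      rw [hUs, Finset.sum_add_distrib, Finset.sum_add_distrib]
      congr 1
      rw [← Finset.sum_range_reflect (fun i =>
        Q (U (z ∘ Sum.inl) (z ∘ Sum.inr) i) (T (z ∘ Sum.inl) (k - i)) c) (k + 1)]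
      refine Finset.sum_congr rfl fun i hi => ?_
      have hik : i ≤ k := Nat.lt_succ_iff.mp (Finset.mem_range.mp hi)
      simp only [show k + 1 - 1 - i = k - i by omega, show k - (k - i) = i by omega]
  have hψ₂ : ∀ s ∈ Icc 0 h, HasDerivWithinAt (fun σ => Sum.elim (ψ σ) (V σ))
      (Q₂ (Sum.elim (ψ s) (V s)) (Sum.elim (ψ s) (V s))) (Icc 0 h) s := by
    intro s hs
    rw [hQ₂]
    refine hasDerivWithinAt_pi.2 ?_
    rintro (c | c)
    · simpa using (hasDerivWithinAt_pi.1 (hψ s hs)) c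
    · simpa using (hasDerivWithinAt_pi.1 (hV s hs)) c
  have hJ₂ : ∀ s ∈ Icc 0 h, |T₂ (Sum.elim (ψ s) (V s)) (p + 1) (Sum.inr c)| ≤ J := fun s hs => by
    simpa [hT₂] using hJ s hs
  intro s hs
  simpa [hT₂] using abs_sub_taylor_le Q₂ hT0₂ hTs₂ hψ₂ hJ₂ s hs

/-- **Box form of the variational remainder**: confinement of the pair in `[lo,hi] × [loV,hiV]` and an order-`p+1`
enclosure `|U y v (p+1) c| ≤ J c` over the product box. [folklore] -/
theorem abs_sub_varTaylor_le_of_mem_Icc (hT0 : ∀ x, T x 0 = x)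
    (hTs : ∀ x (k : ℕ) c, ((k : ℝ) + 1) * T x (k + 1) c =
      ∑ i ∈ Finset.range (k + 1), Q (T x i) (T x (k - i)) c)
    (hU0 : ∀ x v, U x v 0 = v)
    (hUs : ∀ x v (k : ℕ) c, ((k : ℝ) + 1) * U x v (k + 1) c =
      ∑ i ∈ Finset.range (k + 1), (Q (T x i) (U x v (k - i)) c + Q (U x v (k - i)) (T x i) c))
    {ψ V : ℝ → ι → ℝ} {h : ℝ} (hψ : ∀ s ∈ Icc 0 h, HasDerivWithinAt ψ (Q (ψ s) (ψ s)) (Icc 0 h) s)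
    (hV : ∀ s ∈ Icc 0 h, HasDerivWithinAt V (Q (ψ s) (V s) + Q (V s) (ψ s)) (Icc 0 h) s)
    {lo hi loV hiV : ι → ℝ} (hbox : ∀ s ∈ Icc 0 h, ψ s ∈ Icc lo hi) (hboxV : ∀ s ∈ Icc 0 h, V s ∈ Icc loV hiV)
    {p : ℕ} {J : ι → ℝ} (hJ : ∀ y ∈ Icc lo hi, ∀ v ∈ Icc loV hiV, ∀ c, |U y v (p + 1) c| ≤ J c) :
    ∀ s ∈ Icc 0 h, ∀ c,
      |V s c - ∑ k ∈ Finset.range (p + 1), U (ψ 0) (V 0) k c * s ^ k| ≤ J c * s ^ (p + 1) :=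
  fun s hs c => abs_sub_varTaylor_le Q hT0 hTs hU0 hUs hψ hV
    (fun σ hσ => hJ _ (hbox σ hσ) _ (hboxV σ hσ) c) s hs

end Block

/-! ### `Fin n` corollaries next to S1's vocabulary (`IsMajorantSystem`, `IsSolOn`, `flowSel`) -/

section Majorant

open Summit.NavierStokesRegularity.NavierStokesRegularity.Theorems.TaylorModelMajorant

variable {n : ℕ} {Q : (Fin n → ℝ) → (Fin n → ℝ) → Fin n → ℝ} {w : Fin n → ℝ} {b : ℝ}
  {T : (Fin n → ℝ) → ℕ → Fin n → ℝ} {U : (Fin n → ℝ) → (Fin n → ℝ) → ℕ → Fin n → ℝ}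

/-- The field of an `IsMajorantSystem` bundles as a bilinear map (`LinearMap.mk₂`, definitionally `Q u v`).
[folklore] -/
theorem exists_bundle (hS : IsMajorantSystem n Q w b T U) :
    ∃ Qb : (Fin n → ℝ) →ₗ[ℝ] (Fin n → ℝ) →ₗ[ℝ] Fin n → ℝ, ∀ u v, Qb u v = Q u v :=
  ⟨LinearMap.mk₂ ℝ Q (fun u₁ u₂ v => (hS.linear_left v).map_add u₁ u₂)
      (fun r u v => (hS.linear_left v).map_smul r u) (fun u v₁ v₂ => (hS.linear_right u).map_add v₁ v₂)
      (fun r u v => (hS.linear_right u).map_smul r v), fun _ _ => rfl⟩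

/-- **Rough enclosure ⇒ the global selector solves on `[0,h]` and stays in the box** (no `b·m·h < 1`): under
the first-order test `x₀ + u • Q y y ∈ [lo,hi]` (`y ∈ [lo,hi]`, `u ∈ [0,h]`), `s ↦ flowSel Q x₀ s` is a solution
on `[0,h]` in the sense of `IsSolOn` and is confined to `[lo,hi]`. [folklore] -/
theorem flowSel_isSolOn_mem_Icc (hS : IsMajorantSystem n Q w b T U) {lo hi x₀ : Fin n → ℝ} {h : ℝ}
    (hx₀ : x₀ ∈ Icc lo hi) (hh : 0 ≤ h)
    (henc : ∀ y ∈ Icc lo hi, ∀ u ∈ Icc (0:ℝ) h, x₀ + u • Q y y ∈ Icc lo hi) :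
    IsSolOn Q x₀ h (fun s => flowSel Q x₀ s) ∧ ∀ s ∈ Icc 0 h, flowSel Q x₀ s ∈ Icc lo hi := by
  obtain ⟨Qb, hQb⟩ := exists_bundle hS
  have henc' : ∀ y ∈ Icc lo hi, ∀ u ∈ Icc (0:ℝ) h, x₀ + u • Qb y y ∈ Icc lo hi := by
    simpa only [hQb] using henc
  obtain ⟨ψ, h0, hder, hbox⟩ := exists_sol_mem_Icc_of_roughEnclosure Qb hx₀ hh henc'
  have hsol : IsSolOn Q x₀ h ψ := ⟨h0, by simpa only [hQb] using hder⟩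
  have heq : ∀ s ∈ Icc 0 h, flowSel Q x₀ s = ψ s := fun s hs => hS.flowSel_eq hsol hs
  refine ⟨⟨flowSel_zero x₀, fun s hs => ?_⟩, fun s hs => (heq s hs).symm ▸ hbox s hs⟩
  show HasDerivWithinAt (fun s => flowSel Q x₀ s) (Q (flowSel Q x₀ s) (flowSel Q x₀ s)) (Icc 0 h) s
  rw [heq s hs]
  exact (hsol.2 s hs).congr (fun σ hσ => heq σ hσ) (heq s hs)

/-- **Rough enclosure ⇒ componentwise Taylor remainder of the selector**: with an order-`p+1` jet enclosure
`|T y (p+1) c| ≤ J c` over the box, `|flowSel Q x₀ s c − Σ_{k≤p} T x₀ k c s^k| ≤ J c · s^(p+1)` on `[0,h]`.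
[folklore] -/
theorem abs_flowSel_sub_taylor_le (hS : IsMajorantSystem n Q w b T U) {lo hi x₀ : Fin n → ℝ} {h : ℝ}
    (hx₀ : x₀ ∈ Icc lo hi) (hh : 0 ≤ h)
    (henc : ∀ y ∈ Icc lo hi, ∀ u ∈ Icc (0:ℝ) h, x₀ + u • Q y y ∈ Icc lo hi) {p : ℕ} {J : Fin n → ℝ}
    (hJ : ∀ y ∈ Icc lo hi, ∀ c, |T y (p + 1) c| ≤ J c) :
    ∀ s ∈ Icc 0 h, ∀ c,
      |flowSel Q x₀ s c - ∑ k ∈ Finset.range (p + 1), T x₀ k c * s ^ k| ≤ J c * s ^ (p + 1) := by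
  obtain ⟨Qb, hQb⟩ := exists_bundle hS
  have henc' : ∀ y ∈ Icc lo hi, ∀ u ∈ Icc (0:ℝ) h, x₀ + u • Qb y y ∈ Icc lo hi := by
    simpa only [hQb] using henc
  obtain ⟨ψ, h0, hder, hbox⟩ := exists_sol_mem_Icc_of_roughEnclosure Qb hx₀ hh henc'
  have hsol : IsSolOn Q x₀ h ψ := ⟨h0, by simpa only [hQb] using hder⟩
  have hTs : ∀ x (k : ℕ) c, ((k : ℝ) + 1) * T x (k + 1) c =
      ∑ i ∈ Finset.range (k + 1), Qb (T x i) (T x (k - i)) c := by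
    simpa only [hQb] using hS.T_succ
  intro s hs c
  have key := abs_sub_taylor_le_of_mem_Icc Qb hS.T_zero hTs hder hbox hJ s hs c
  rwa [h0, ← hS.flowSel_eq hsol hs] at key

end Majorant

end Summit.NavierStokesRegularity.NavierStokesRegularity.Theorems.TaylorModelVector

end
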